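import Literature.AlgebraicGeometry.ModuliOfAbelianVarieties.SiegelModuliDatumLocalBiholomorphism
import Literature.AlgebraicGeometry.ModuliOfAbelianVarieties.SiegelComplexRecordSystem
import Literature.NumberTheory.Transcendental.AnalytificationCoordinateHolomorphyTransport
import HarnessLib

/-!
# The Siegel uniformisation followed by a morphism is holomorphic INTO any analytification

Topic `Literature/AlgebraicGeometry/ModuliOfAbelianVarieties`, namespace
`Literature.AlgebraicGeometry.ModuliOfAbelianVarieties` (grouping sub-namespaces `SiegelModuliDatum`,
`SiegelComplexRecordSystem`).  THEOREMS ONLY (no `def`, no named fact, no instance, no `sorry`).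

For a Siegel fine moduli datum `D : SiegelModuliDatum g δ N` (★ `SiegelModuliDatum`: uniformisation
`D.unif : 𝔥_g → S(ℂ)`, continuous on `𝔥_g` and holomorphic in algebraic coordinates — fields
`continuousOn_unif`, `differentiableOn_unif`), ANY `ℂ`-scheme `Y` smooth of some relative dimension
`m` with an analytification `ψ : M' → Y(ℂ)` carrying a holomorphic atlas
(★ `Transcendental.IsAnalytification`), and ANY morphism `j : D.S ⟶ Y`, the lift

  `ψ⁻¹ ∘ j(ℂ) ∘ unif : 𝔥_g → M'`

is holomorphic — read on `𝔥_g ⊆ ℂ^{g(g+1)/2}` in Klingen's coordinates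
(`SiegelUpperHalfSpace.siegelUpperHalfSpaceCoord`, `coordCLE`), and, more generally, through any
matrix-valued parametrisation `W : G ⊇ O → 𝔥_g` with holomorphic entries on an open set `O` of a
complex normed space `G` (`SiegelModuliDatum.mdifferentiableAt_symm_comp_map_unif_coord`,
`SiegelModuliDatum.mdifferentiableAt_symm_comp_map_unif_param`).  The record-level corollaries for a
Siegel complex record system `Sg : SiegelComplexRecordSystem g δ` read the piece `q` of `Sg.Mc_{KN}`
through `Sg.incl KN q ≫ e` for any `e : Sg.Mc_{KN} ⟶ Y`
(`SiegelComplexRecordSystem.mdifferentiableAt_symm_comp_map_incl_unif_coord`, `…_param`).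
No hypothesis `0 < δ i` / `3 ≤ N` is used: only continuity and coordinate-holomorphy of `unif`.

PROOF.  Serre's criterion «a map into `Y^h` is holomorphic iff regular functions on affine opens pull
back to holomorphic functions» (★ `IsAnalytification.mdifferentiableAt_symm_comp`, GAGA §2 n°5–6),
fed by ★ `differentiableOn_evalOrZero_map_comp` (regular functions on `Y` pull back along `j` to
regular functions on `D.S`, GAGA §2 n°5) and the datum's clause `differentiableOn_unif`
([CharlesSchnell2014Notes] Thm. 11.5.10: `𝔥_g` «is isomorphic to the universal covering space of the
quasi-projective complex manifold `𝓜_{g,d,N}`», in particular the covering map is holomorphic).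

Consumer: row #61 `ShimuraVarieties.siegel_borel_extension` of cell hodgecm-mathlib (Borel's
extension theorem in the Chow + Zariski form, via ★ `Transcendental.arapura2012_cor_15_4_6_holds` with
target `Y = ℙᵇ_ℂ`, `ψ = Transcendental.projPoint b`): the Siegel half of «`f` is holomorphic between
the analytifications».

## References

* [SerreGAGA1956] J.-P. Serre, *Géométrie algébrique et géométrie analytique*, Ann. Inst. Fourier 6
  (1956), §2 n°5 (applications holomorphes dans `X^h`; fonctorialité) and n°6 Prop. 3 Cor. 2.
* [CharlesSchnell2014Notes] F. Charles, C. Schnell, *Notes on absolute Hodge classes* (2014),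
  Thm. 11.5.10 (p. 516).
* [GenestierNgo2020] A. Genestier, B. C. Ngô, *Lectures on Shimura varieties*, Prop. 1.3.2.
-/

noncomputable section

open Set Function Filter TopologicalSpace CategoryTheory AlgebraicGeometry Matrix
open scoped Manifold ContDiff Topology Matrix.Norms.Elementwise

namespace Literature.AlgebraicGeometry.ModuliOfAbelianVarieties

open Literature.AlgebraicGeometry.Motives (ComplexPoints AlgPoints SchemeOver)
open Literature.AlgebraicGeometry.Motives.AlgPoints
open Literature.NumberTheory.Automorphic (siegelUpperHalfSpace)
open Literature.NumberTheory.ModularForms.SiegelUpperHalfSpace (siegelUpperHalfSpaceCoord coordCLE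
  isOpen_siegelUpperHalfSpaceCoord mem_siegelUpperHalfSpaceCoord_iff)
open Literature.NumberTheory.Transcendental
open Literature.LinearAlgebra.Matrix (symmetricSubmodule)

namespace SiegelModuliDatum

variable {g : ℕ} {δ : Fin g → ℕ} {N : ℕ} (D : SiegelModuliDatum g δ N)
variable {Y : SchemeOver ℂ}

/-! ### §1. Through a holomorphic matrix-valued parametrisation `W : G ⊇ O → 𝔥_g` -/

section Param

variable {G : Type*} [NormedAddCommGroup G] [NormedSpace ℂ G]
  {W : G → Matrix (Fin g) (Fin g) ℂ} {O : Set G}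

/-- A matrix-valued map with holomorphic entries on `O` is holomorphic on `O` (elementwise norm).
[cite: SerreGAGA1956, §2 n°5] -/
theorem differentiableOn_matrix_of_entry (hW : ∀ i k, DifferentiableOn ℂ (fun x ↦ W x i k) O) :
    DifferentiableOn ℂ W O :=
  differentiableOn_pi.2 fun i ↦ differentiableOn_pi.2 fun k ↦ hW i k

/-- A matrix-valued map with holomorphic entries on `O` is continuous on `O`.
[cite: SerreGAGA1956, §2 n°5] -/
theorem continuousOn_matrix_of_entry (hW : ∀ i k, DifferentiableOn ℂ (fun x ↦ W x i k) O) :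
    ContinuousOn W O :=
  (differentiableOn_matrix_of_entry hW).continuousOn

/-- **`unif ∘ W` is continuous on `O`** for a parametrisation `W : O → 𝔥_g` with holomorphic entries
(field `continuousOn_unif`). [cite: CharlesSchnell2014Notes, Thm. 11.5.10 (p. 516)] -/
theorem continuousOn_unif_param (hW : ∀ i k, DifferentiableOn ℂ (fun x ↦ W x i k) O)
    (hWmem : MapsTo W O (siegelUpperHalfSpace g)) :
    ContinuousOn (fun x ↦ D.unif (W x)) O :=
  D.continuousOn_unif.comp (continuousOn_matrix_of_entry hW) hWmem

/-- **`unif ∘ W` is holomorphic in algebraic coordinates**: every regular function on an affine open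
`U ⊆ S`, read through `x ↦ unif (W x)`, is holomorphic on the part of `O` above `U` (field
`differentiableOn_unif` composed with `W`). [cite: CharlesSchnell2014Notes, Thm. 11.5.10 (p. 516)] -/
theorem differentiableOn_unif_param (hW : ∀ i k, DifferentiableOn ℂ (fun x ↦ W x i k) O)
    (hWmem : MapsTo W O (siegelUpperHalfSpace g)) (U : D.S.left.affineOpens)
    (s : D.S.left.presheaf.obj (Opposite.op (↑U : D.S.left.Opens))) :
    DifferentiableOn ℂ (fun x ↦ evalOrZero (↑U : D.S.left.Opens) s (D.unif (W x)))
      (O ∩ (fun x ↦ D.unif (W x)) ⁻¹' {P | P.pt ∈ (↑U : D.S.left.Opens)}) := by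
  have hmaps : MapsTo W (O ∩ (fun x ↦ D.unif (W x)) ⁻¹' {P | P.pt ∈ (↑U : D.S.left.Opens)})
      (siegelUpperHalfSpace g ∩ D.unif ⁻¹' {P | P.pt ∈ (↑U : D.S.left.Opens)}) :=
    fun x hx ↦ ⟨hWmem hx.1, hx.2⟩
  exact (D.differentiableOn_unif U s).comp ((differentiableOn_matrix_of_entry hW).mono inter_subset_left)
    hmaps

/-- **`j(ℂ) ∘ unif ∘ W` is continuous on `O`** for every morphism `j : S ⟶ Y`.
[cite: SerreGAGA1956, §2 n°5] -/
theorem continuousOn_map_unif_param (hW : ∀ i k, DifferentiableOn ℂ (fun x ↦ W x i k) O)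
    (hWmem : MapsTo W O (siegelUpperHalfSpace g)) (j : D.S ⟶ Y) :
    ContinuousOn (fun x ↦ AlgPoints.map j (D.unif (W x))) O :=
  continuousOn_map_comp (D.continuousOn_unif_param hW hWmem) j

/-- **`j(ℂ) ∘ unif ∘ W` is holomorphic in the algebraic coordinates of `Y`**: regular functions on
affine opens of `Y` pull back along `j` to regular functions on opens of `S` (GAGA §2 n°5), which are
holomorphic through `unif ∘ W`. [cite: SerreGAGA1956, §2 n°5] -/
theorem differentiableOn_evalOrZero_map_unif_param (hO : IsOpen O)
    (hW : ∀ i k, DifferentiableOn ℂ (fun x ↦ W x i k) O)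
    (hWmem : MapsTo W O (siegelUpperHalfSpace g)) (j : D.S ⟶ Y) (U : Y.left.affineOpens)
    (s : Y.left.presheaf.obj (Opposite.op (↑U : Y.left.Opens))) :
    DifferentiableOn ℂ (fun x ↦ evalOrZero (↑U : Y.left.Opens) s (AlgPoints.map j (D.unif (W x))))
      (O ∩ (fun x ↦ AlgPoints.map j (D.unif (W x))) ⁻¹' {P | P.pt ∈ (↑U : Y.left.Opens)}) :=
  differentiableOn_evalOrZero_map_comp hO (D.continuousOn_unif_param hW hWmem)
    (D.differentiableOn_unif_param hW hWmem) j U s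

variable {E' : Type*} [NormedAddCommGroup E'] [NormedSpace ℂ E'] [FiniteDimensional ℂ E']
  {M' : Type*} [TopologicalSpace M'] [ChartedSpace E' M'] {m : ℕ} {ψ : M' → ComplexPoints Y}

/-- **The Siegel uniformisation followed by a morphism is holomorphic into any analytification,
through any holomorphic parametrisation.**  For `Y` smooth of relative dimension `m` over `ℂ` with an
analytification `ψ : M' → Y(ℂ)` (holomorphic atlas), a morphism `j : S ⟶ Y`, and `W : G ⊇ O → 𝔥_g`
with holomorphic entries on the open set `O`, the lift `ψ⁻¹ ∘ j(ℂ) ∘ unif ∘ W : O → M'` is holomorphic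
at every point of `O` (holomorphy into `Y^h` is tested on regular functions, GAGA §2 n°6 Prop. 3
Cor. 2; ★ `IsAnalytification.mdifferentiableAt_symm_comp`).
[cite: SerreGAGA1956, §2 n°5 Prop. 2 and n°6 Prop. 3 Cor. 2] [cite: CharlesSchnell2014Notes, Thm. 11.5.10 (p. 516)] -/
theorem mdifferentiableAt_symm_comp_map_unif_param [SmoothOfRelativeDimension m Y.hom]
    [IsManifold 𝓘(ℂ, E') ω M'] (hψ : IsAnalytification E' Y m ψ) (j : D.S ⟶ Y) (hO : IsOpen O)
    (hW : ∀ i k, DifferentiableOn ℂ (fun x ↦ W x i k) O)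
    (hWmem : MapsTo W O (siegelUpperHalfSpace g)) {x : G} (hx : x ∈ O) :
    MDifferentiableAt 𝓘(ℂ, G) 𝓘(ℂ, E')
      (hψ.homeomorph.symm ∘ fun x ↦ AlgPoints.map j (D.unif (W x))) x :=
  hψ.mdifferentiableAt_symm_comp hO (D.continuousOn_map_unif_param hW hWmem j)
    (D.differentiableOn_evalOrZero_map_unif_param hO hW hWmem j) hx

/-- `MDifferentiableOn` form of `mdifferentiableAt_symm_comp_map_unif_param` on the open set `O`.
[cite: SerreGAGA1956, §2 n°5 Prop. 2 and n°6 Prop. 3 Cor. 2] -/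
theorem mdifferentiableOn_symm_comp_map_unif_param [SmoothOfRelativeDimension m Y.hom]
    [IsManifold 𝓘(ℂ, E') ω M'] (hψ : IsAnalytification E' Y m ψ) (j : D.S ⟶ Y) (hO : IsOpen O)
    (hW : ∀ i k, DifferentiableOn ℂ (fun x ↦ W x i k) O)
    (hWmem : MapsTo W O (siegelUpperHalfSpace g)) :
    MDifferentiableOn 𝓘(ℂ, G) 𝓘(ℂ, E')
      (hψ.homeomorph.symm ∘ fun x ↦ AlgPoints.map j (D.unif (W x))) O :=
  fun _ hx ↦ (D.mdifferentiableAt_symm_comp_map_unif_param hψ j hO hW hWmem hx).mdifferentiableWithinAt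

/-- Continuity of the lift `ψ⁻¹ ∘ j(ℂ) ∘ unif ∘ W` on `O`. [cite: SerreGAGA1956, §2 n°5] -/
theorem continuousOn_symm_comp_map_unif_param (hψ : IsAnalytification E' Y m ψ) (j : D.S ⟶ Y)
    (hW : ∀ i k, DifferentiableOn ℂ (fun x ↦ W x i k) O)
    (hWmem : MapsTo W O (siegelUpperHalfSpace g)) :
    ContinuousOn (hψ.homeomorph.symm ∘ fun x ↦ AlgPoints.map j (D.unif (W x))) O :=
  hψ.homeomorph.symm.continuous.comp_continuousOn (D.continuousOn_map_unif_param hW hWmem j)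

omit [NormedAddCommGroup G] [NormedSpace ℂ G] in
/-- The lift evaluates back: `ψ (ψ⁻¹ (j(ℂ) (unif (W x)))) = j(ℂ) (unif (W x))`.
[cite: SerreGAGA1956, §2 n°5] -/
theorem apply_symm_comp_map_unif_param (hψ : IsAnalytification E' Y m ψ) (j : D.S ⟶ Y) (x : G) :
    ψ ((hψ.homeomorph.symm ∘ fun x ↦ AlgPoints.map j (D.unif (W x))) x) =
      AlgPoints.map j (D.unif (W x)) := by
  simpa only [Function.comp_apply, hψ.coe_homeomorph] using
    hψ.homeomorph.apply_symm_apply (AlgPoints.map j (D.unif (W x)))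

end Param

/-! ### §2. In Klingen's coordinates `𝔥_g ⊆ ℂ^{g(g+1)/2}` -/

section Coord

/-- The Klingen coordinate parametrisation `v ↦ Z(v)` has holomorphic (indeed linear) entries.
[cite: GenestierNgo2020, Prop. 1.3.2] -/
theorem differentiableOn_coordCLE_symm_entry (O : Set (Sym2 (Fin g) → ℂ)) (i k : Fin g) :
    DifferentiableOn ℂ (fun v : Sym2 (Fin g) → ℂ ↦
      (((coordCLE g).symm v : symmetricSubmodule (Fin g) ℂ) : Matrix (Fin g) (Fin g) ℂ) i k) O := by
  set L : (Sym2 (Fin g) → ℂ) →L[ℂ] Matrix (Fin g) (Fin g) ℂ :=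
    (symmetricSubmodule (Fin g) ℂ).subtypeL.comp ((coordCLE g).symm : _ →L[ℂ] _) with hL
  have hLv : ∀ v, L v = (((coordCLE g).symm v : symmetricSubmodule (Fin g) ℂ) :
      Matrix (Fin g) (Fin g) ℂ) := fun v ↦ rfl
  have hLd : DifferentiableOn ℂ L O := L.differentiableOn
  have h := differentiableOn_pi.1 (differentiableOn_pi.1 hLd i) k
  refine h.congr fun v _ ↦ ?_
  simp only [hLv]

/-- The Klingen coordinate parametrisation maps `siegelUpperHalfSpaceCoord g` into `𝔥_g`.
[cite: GenestierNgo2020, Prop. 1.3.2] -/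
theorem mapsTo_coordCLE_symm_siegelUpperHalfSpace :
    MapsTo (fun v : Sym2 (Fin g) → ℂ ↦
      (((coordCLE g).symm v : symmetricSubmodule (Fin g) ℂ) : Matrix (Fin g) (Fin g) ℂ))
      (siegelUpperHalfSpaceCoord g) (siegelUpperHalfSpace g) :=
  fun _ hv ↦ (mem_siegelUpperHalfSpaceCoord_iff).1 hv

/-- **The coordinate uniformisation `v ↦ unif (Z(v))` is continuous on `𝔥_g ⊆ ℂ^{g(g+1)/2}`**
(field `continuousOn_unif`; no torsion-freeness of the level is needed).
[cite: CharlesSchnell2014Notes, Thm. 11.5.10 (p. 516)] -/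
theorem continuousOn_unif_coord :
    ContinuousOn (fun v : Sym2 (Fin g) → ℂ ↦ D.unif
      (((coordCLE g).symm v : symmetricSubmodule (Fin g) ℂ) : Matrix (Fin g) (Fin g) ℂ))
      (siegelUpperHalfSpaceCoord g) :=
  D.continuousOn_unif_param (differentiableOn_coordCLE_symm_entry _)
    mapsTo_coordCLE_symm_siegelUpperHalfSpace

variable {E' : Type*} [NormedAddCommGroup E'] [NormedSpace ℂ E'] [FiniteDimensional ℂ E']
  {M' : Type*} [TopologicalSpace M'] [ChartedSpace E' M'] {m : ℕ} {ψ : M' → ComplexPoints Y}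

/-- **`j(ℂ) ∘ unif ∘ Z(·)` is holomorphic in the algebraic coordinates of `Y`** on
`𝔥_g ⊆ ℂ^{g(g+1)/2}`, for every morphism `j : S ⟶ Y`. [cite: SerreGAGA1956, §2 n°5] -/
theorem differentiableOn_evalOrZero_map_unif_coord (j : D.S ⟶ Y) (U : Y.left.affineOpens)
    (s : Y.left.presheaf.obj (Opposite.op (↑U : Y.left.Opens))) :
    DifferentiableOn ℂ (fun v : Sym2 (Fin g) → ℂ ↦ evalOrZero (↑U : Y.left.Opens) s
        (AlgPoints.map j (D.unif
          (((coordCLE g).symm v : symmetricSubmodule (Fin g) ℂ) : Matrix (Fin g) (Fin g) ℂ))))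
      (siegelUpperHalfSpaceCoord g ∩
        (fun v ↦ AlgPoints.map j (D.unif
          (((coordCLE g).symm v : symmetricSubmodule (Fin g) ℂ) : Matrix (Fin g) (Fin g) ℂ))) ⁻¹'
          {P | P.pt ∈ (↑U : Y.left.Opens)}) :=
  D.differentiableOn_evalOrZero_map_unif_param isOpen_siegelUpperHalfSpaceCoord
    (differentiableOn_coordCLE_symm_entry _) mapsTo_coordCLE_symm_siegelUpperHalfSpace j U s

/-- **The Siegel uniformisation followed by a morphism is holomorphic into any analytification
(Klingen coordinates).**  For `Y` smooth of relative dimension `m` over `ℂ` with an analytification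
`ψ : M' → Y(ℂ)` (holomorphic atlas) and a morphism `j : S ⟶ Y`, the lift `ψ⁻¹ ∘ j(ℂ) ∘ unif ∘ Z(·)`
is holomorphic at every point of `𝔥_g ⊆ ℂ^{g(g+1)/2}`.  With `Y = S`, `j = 𝟙` this is
★ `SiegelModuliDatum.mdifferentiableAt_unif_lift` without its `0 < δ i` / `3 ≤ N` binders.
[cite: SerreGAGA1956, §2 n°5 Prop. 2 and n°6 Prop. 3 Cor. 2] [cite: GenestierNgo2020, Prop. 1.3.2] -/
theorem mdifferentiableAt_symm_comp_map_unif_coord [SmoothOfRelativeDimension m Y.hom]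
    [IsManifold 𝓘(ℂ, E') ω M'] (hψ : IsAnalytification E' Y m ψ) (j : D.S ⟶ Y)
    {v : Sym2 (Fin g) → ℂ} (hv : v ∈ siegelUpperHalfSpaceCoord g) :
    MDifferentiableAt 𝓘(ℂ, Sym2 (Fin g) → ℂ) 𝓘(ℂ, E')
      (hψ.homeomorph.symm ∘ fun v ↦ AlgPoints.map j (D.unif
        (((coordCLE g).symm v : symmetricSubmodule (Fin g) ℂ) : Matrix (Fin g) (Fin g) ℂ))) v :=
  D.mdifferentiableAt_symm_comp_map_unif_param hψ j isOpen_siegelUpperHalfSpaceCoord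
    (differentiableOn_coordCLE_symm_entry _) mapsTo_coordCLE_symm_siegelUpperHalfSpace hv

/-- `MDifferentiableOn` form of `mdifferentiableAt_symm_comp_map_unif_coord` on
`siegelUpperHalfSpaceCoord g`. [cite: SerreGAGA1956, §2 n°5 Prop. 2 and n°6 Prop. 3 Cor. 2] -/
theorem mdifferentiableOn_symm_comp_map_unif_coord [SmoothOfRelativeDimension m Y.hom]
    [IsManifold 𝓘(ℂ, E') ω M'] (hψ : IsAnalytification E' Y m ψ) (j : D.S ⟶ Y) :
    MDifferentiableOn 𝓘(ℂ, Sym2 (Fin g) → ℂ) 𝓘(ℂ, E')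
      (hψ.homeomorph.symm ∘ fun v ↦ AlgPoints.map j (D.unif
        (((coordCLE g).symm v : symmetricSubmodule (Fin g) ℂ) : Matrix (Fin g) (Fin g) ℂ)))
      (siegelUpperHalfSpaceCoord g) :=
  D.mdifferentiableOn_symm_comp_map_unif_param hψ j isOpen_siegelUpperHalfSpaceCoord
    (differentiableOn_coordCLE_symm_entry _) mapsTo_coordCLE_symm_siegelUpperHalfSpace

/-- **The Siegel uniformisation itself is holomorphic into any analytification of the base**
(Klingen coordinates; `j = 𝟙`): ★ `mdifferentiableAt_unif_lift` without level hypotheses.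
[cite: GenestierNgo2020, Prop. 1.3.2] -/
theorem mdifferentiableAt_symm_comp_unif_coord {ψ : M' → ComplexPoints D.S}
    [SmoothOfRelativeDimension m D.S.hom] [IsManifold 𝓘(ℂ, E') ω M']
    (hψ : IsAnalytification E' D.S m ψ) {v : Sym2 (Fin g) → ℂ} (hv : v ∈ siegelUpperHalfSpaceCoord g) :
    MDifferentiableAt 𝓘(ℂ, Sym2 (Fin g) → ℂ) 𝓘(ℂ, E')
      (hψ.homeomorph.symm ∘ fun v ↦ D.unif
        (((coordCLE g).symm v : symmetricSubmodule (Fin g) ℂ) : Matrix (Fin g) (Fin g) ℂ)) v := by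
  have h := D.mdifferentiableAt_symm_comp_map_unif_coord hψ (𝟙 D.S) hv
  have hfun : (hψ.homeomorph.symm ∘ fun v ↦ AlgPoints.map (𝟙 D.S) (D.unif
        (((coordCLE g).symm v : symmetricSubmodule (Fin g) ℂ) : Matrix (Fin g) (Fin g) ℂ))) =
      (hψ.homeomorph.symm ∘ fun v ↦ D.unif
        (((coordCLE g).symm v : symmetricSubmodule (Fin g) ℂ) : Matrix (Fin g) (Fin g) ℂ)) := by
    funext v
    simp only [Function.comp_apply, AlgPoints.map_id_apply]
  rwa [hfun] at h

end Coord

end SiegelModuliDatum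

/-! ### §3. Record level: the piece `q` of `Sg.Mc_{KN}` read through `Sg.incl KN q ≫ e` -/

namespace SiegelComplexRecordSystem

variable {g : ℕ} {δ : Fin g → ℕ} (Sg : SiegelComplexRecordSystem g δ)
variable {Y : SchemeOver ℂ}
  {E' : Type*} [NormedAddCommGroup E'] [NormedSpace ℂ E'] [FiniteDimensional ℂ E']
  {M' : Type*} [TopologicalSpace M'] [ChartedSpace E' M'] {m : ℕ} {ψ : M' → ComplexPoints Y}

/-- **Siegel half of «`f` is holomorphic between the analytifications» (row #61).**  For a Siegel
complex record system `Sg`, a level `KN`, a piece `q : Sg.Q KN`, ANY `ℂ`-scheme `Y` smooth of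
relative dimension `m` with an analytification `ψ : M' → Y(ℂ)` (holomorphic atlas) and ANY morphism
`e : Sg.Mc_{KN} ⟶ Y`, the lift `ψ⁻¹ ∘ e(ℂ) ∘ (Sg.incl KN q)(ℂ) ∘ unif_q ∘ Z(·)` is holomorphic at
every point of `𝔥_g ⊆ ℂ^{g(g+1)/2}` (Klingen coordinates).  No `0 < δ i` binder is needed.
[cite: SerreGAGA1956, §2 n°5 Prop. 2 and n°6 Prop. 3 Cor. 2] [cite: GenestierNgo2020, Prop. 1.3.2] -/
theorem mdifferentiableAt_symm_comp_map_incl_unif_coord [SmoothOfRelativeDimension m Y.hom]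
    [IsManifold 𝓘(ℂ, E') ω M'] (hψ : IsAnalytification E' Y m ψ) (KN : SiegelLevel δ) (q : Sg.Q KN)
    (e : Sg.Mc.obj KN ⟶ Y) {v : Sym2 (Fin g) → ℂ} (hv : v ∈ siegelUpperHalfSpaceCoord g) :
    MDifferentiableAt 𝓘(ℂ, Sym2 (Fin g) → ℂ) 𝓘(ℂ, E')
      (hψ.homeomorph.symm ∘ fun v ↦ AlgPoints.map (Sg.incl KN q ≫ e) ((Sg.datum KN q).unif
        (((coordCLE g).symm v : symmetricSubmodule (Fin g) ℂ) : Matrix (Fin g) (Fin g) ℂ))) v :=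
  (Sg.datum KN q).mdifferentiableAt_symm_comp_map_unif_coord hψ (Sg.incl KN q ≫ e) hv

/-- `MDifferentiableOn` form of `mdifferentiableAt_symm_comp_map_incl_unif_coord` on
`siegelUpperHalfSpaceCoord g`. [cite: SerreGAGA1956, §2 n°5 Prop. 2 and n°6 Prop. 3 Cor. 2] -/
theorem mdifferentiableOn_symm_comp_map_incl_unif_coord [SmoothOfRelativeDimension m Y.hom]
    [IsManifold 𝓘(ℂ, E') ω M'] (hψ : IsAnalytification E' Y m ψ) (KN : SiegelLevel δ) (q : Sg.Q KN)
    (e : Sg.Mc.obj KN ⟶ Y) :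
    MDifferentiableOn 𝓘(ℂ, Sym2 (Fin g) → ℂ) 𝓘(ℂ, E')
      (hψ.homeomorph.symm ∘ fun v ↦ AlgPoints.map (Sg.incl KN q ≫ e) ((Sg.datum KN q).unif
        (((coordCLE g).symm v : symmetricSubmodule (Fin g) ℂ) : Matrix (Fin g) (Fin g) ℂ)))
      (siegelUpperHalfSpaceCoord g) :=
  (Sg.datum KN q).mdifferentiableOn_symm_comp_map_unif_coord hψ (Sg.incl KN q ≫ e)

/-- The piece's uniformisation read in `Sg.Mc_{KN}` itself: `ψ⁻¹ ∘ (Sg.incl KN q)(ℂ) ∘ unif_q ∘ Z(·)`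
is holomorphic on `𝔥_g ⊆ ℂ^{g(g+1)/2}` for every analytification `ψ` of `Sg.Mc_{KN}` (no level
hypothesis; cf. the `hδ`/`3 ≤ N` route through ★ `isLocalHomeomorph_restrict_unif_coord`).
[cite: GenestierNgo2020, Prop. 1.3.2] -/
theorem mdifferentiableAt_symm_comp_incl_unif_coord (KN : SiegelLevel δ)
    {ψ : M' → ComplexPoints (Sg.Mc.obj KN)} [SmoothOfRelativeDimension m (Sg.Mc.obj KN).hom]
    [IsManifold 𝓘(ℂ, E') ω M'] (hψ : IsAnalytification E' (Sg.Mc.obj KN) m ψ) (q : Sg.Q KN)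
    {v : Sym2 (Fin g) → ℂ} (hv : v ∈ siegelUpperHalfSpaceCoord g) :
    MDifferentiableAt 𝓘(ℂ, Sym2 (Fin g) → ℂ) 𝓘(ℂ, E')
      (hψ.homeomorph.symm ∘ fun v ↦ AlgPoints.map (Sg.incl KN q) ((Sg.datum KN q).unif
        (((coordCLE g).symm v : symmetricSubmodule (Fin g) ℂ) : Matrix (Fin g) (Fin g) ℂ))) v :=
  (Sg.datum KN q).mdifferentiableAt_symm_comp_map_unif_coord hψ (Sg.incl KN q) hv

variable {G : Type*} [NormedAddCommGroup G] [NormedSpace ℂ G]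
  {W : G → Matrix (Fin g) (Fin g) ℂ} {O : Set G}

/-- **Parametrised form (the shape `HasHolomorphicSiegelLift` supplies).**  For `W : G ⊇ O → 𝔥_g`
with holomorphic entries on the open set `O` (e.g. `O` a ball chart and `W = Z ∘ (T·lift)`), the lift
`ψ⁻¹ ∘ e(ℂ) ∘ (Sg.incl KN q)(ℂ) ∘ unif_q ∘ W : O → M'` is holomorphic at every point of `O`.
[cite: SerreGAGA1956, §2 n°5 Prop. 2 and n°6 Prop. 3 Cor. 2] [cite: CharlesSchnell2014Notes, Thm. 11.5.10 (p. 516)] -/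
theorem mdifferentiableAt_symm_comp_map_incl_unif_param [SmoothOfRelativeDimension m Y.hom]
    [IsManifold 𝓘(ℂ, E') ω M'] (hψ : IsAnalytification E' Y m ψ) (KN : SiegelLevel δ) (q : Sg.Q KN)
    (e : Sg.Mc.obj KN ⟶ Y) (hO : IsOpen O) (hW : ∀ i k, DifferentiableOn ℂ (fun x ↦ W x i k) O)
    (hWmem : MapsTo W O (siegelUpperHalfSpace g)) {x : G} (hx : x ∈ O) :
    MDifferentiableAt 𝓘(ℂ, G) 𝓘(ℂ, E')
      (hψ.homeomorph.symm ∘ fun x ↦ AlgPoints.map (Sg.incl KN q ≫ e) ((Sg.datum KN q).unif (W x))) x :=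
  (Sg.datum KN q).mdifferentiableAt_symm_comp_map_unif_param hψ (Sg.incl KN q ≫ e) hO hW hWmem hx

/-- Continuity on `O` of the parametrised lift `ψ⁻¹ ∘ e(ℂ) ∘ (Sg.incl KN q)(ℂ) ∘ unif_q ∘ W`.
[cite: SerreGAGA1956, §2 n°5] -/
theorem continuousOn_symm_comp_map_incl_unif_param (hψ : IsAnalytification E' Y m ψ)
    (KN : SiegelLevel δ) (q : Sg.Q KN) (e : Sg.Mc.obj KN ⟶ Y)
    (hW : ∀ i k, DifferentiableOn ℂ (fun x ↦ W x i k) O)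
    (hWmem : MapsTo W O (siegelUpperHalfSpace g)) :
    ContinuousOn
      (hψ.homeomorph.symm ∘ fun x ↦ AlgPoints.map (Sg.incl KN q ≫ e) ((Sg.datum KN q).unif (W x))) O :=
  (Sg.datum KN q).continuousOn_symm_comp_map_unif_param hψ (Sg.incl KN q ≫ e) hW hWmem

omit [NormedAddCommGroup G] [NormedSpace ℂ G] in
/-- The parametrised lift evaluates back through `ψ`:
`ψ (lift x) = e(ℂ) ((Sg.incl KN q)(ℂ) (unif_q (W x)))`. [cite: SerreGAGA1956, §2 n°5] -/
theorem apply_symm_comp_map_incl_unif_param (hψ : IsAnalytification E' Y m ψ) (KN : SiegelLevel δ)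
    (q : Sg.Q KN) (e : Sg.Mc.obj KN ⟶ Y) (x : G) :
    ψ ((hψ.homeomorph.symm ∘ fun x ↦ AlgPoints.map (Sg.incl KN q ≫ e) ((Sg.datum KN q).unif (W x))) x) =
      AlgPoints.map e (AlgPoints.map (Sg.incl KN q) ((Sg.datum KN q).unif (W x))) := by
  rw [(Sg.datum KN q).apply_symm_comp_map_unif_param hψ (Sg.incl KN q ≫ e) x, AlgPoints.map_comp_apply]

end SiegelComplexRecordSystem

end Literature.AlgebraicGeometry.ModuliOfAbelianVarieties
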